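import Summits.Ventures.PercRepro.ProfilePointedSpanning

/-!
# PercRepro — THE CAPTURED FIRST MOMENT IS «p PREFERS THE SPANNING SIDE», II: THE IDENTITY AND (C1′) ⟺ (★)
(p10, gen 15; `proofs/P10-AVFULL.md` §23(c); continues ProfilePointedSpanning)

Summing the per-element count of ProfilePointedSpanning over `e ∈ E ∖ p`: IDENTITY I `Σ_{X ∈ DC} (2 #X − N + 1) = S1 − S2 + #𝒦`
(`sum_avoid_signed`); IDENTITY II, the complement `X ↦ (E ∖ p) ∖ X` is an involution of `CC = DC ∖ 𝒦` reversing the sign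
of `2 #X − N + 1`, so `Σ_{X ∈ CC} (2 #X − N + 1) = 0` (`sum_extSets_signed`); hence THE IDENTITY
`Σ_{X ∈ 𝒦} (2 #X − N) = S1 − S2` (`sum_capSets_eq_cross`), which by the level decomposition (`sum_capSets_eq_levels`)
gives **(C1′) ⟺ (★)** (`capLimit_iff_pointedSpanning`).  Nothing here asserts (★) or (C1′).
-/

open scoped Matroid

namespace PercRepro.Cogirth

open Finset ThmH Skew

variable {α : Type} [DecidableEq α] {M : Matroid α} [M.Finite]

/-- **IDENTITY I**: `Σ_{X ∈ DC} (2 #X − N + 1) = S1 − S2 + #𝒦`. -/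
theorem sum_avoid_signed {p : α} (hp : p ∈ gr M) :
    ∑ X ∈ avoidSets M p, (2 * (X.card : ℤ) - (gr M).card + 1) =
      (crossIn M p : ℤ) - crossOut M p + (capSets M p).card := by
  have hN : 1 ≤ (gr M).card := card_pos.2 ⟨p, hp⟩
  have hsum : ∑ e ∈ (gr M).erase p,
      ((((avoidSets M p).filter (fun X => e ∈ X)).card : ℤ) -
        ((avoidSets M p).filter (fun X => e ∉ X)).card) =
      ∑ e ∈ (gr M).erase p,
      ((((avoidSets M p).filter (fun X => e ∈ X ∧ e ∈ clF M (gr M \ X))).card : ℤ) -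
        ((avoidSets M p).filter (fun X => e ∉ X ∧ e ∈ clF M X)).card) := by
    apply sum_congr rfl
    intro e he
    rw [mem_erase] at he
    exact card_avoid_mem_sub he.2 he.1
  rw [sum_sub_distrib, sum_sub_distrib] at hsum
  have hA : ∑ e ∈ (gr M).erase p, (((avoidSets M p).filter (fun X => e ∈ X)).card : ℤ) =
      ∑ X ∈ avoidSets M p, (X.card : ℤ) := by exact_mod_cast sum_card_avoid_mem (M := M) p
  have hB : ∑ e ∈ (gr M).erase p, (((avoidSets M p).filter (fun X => e ∉ X)).card : ℤ) =
      ∑ X ∈ avoidSets M p, (((gr M).card : ℤ) - 1 - X.card) := by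
    have h0 := sum_card_avoid_notMem (M := M) hp
    have h1 : ((∑ X ∈ avoidSets M p, ((gr M).card - 1 - X.card) : ℕ) : ℤ) =
        ∑ X ∈ avoidSets M p, (((gr M).card : ℤ) - 1 - X.card) := by
      push_cast
      apply sum_congr rfl
      intro X hX
      have h2 : X.card + 1 ≤ (gr M).card := by
        have := card_le_card (subset_erase_of_mem_avoidSets hX)
        rw [card_erase_of_mem hp] at this
        omega
      rw [Nat.cast_sub (by omega : X.card ≤ (gr M).card - 1), Nat.cast_sub hN]
      push_cast
      ring
    rw [← h1, ← h0]
    push_cast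
    rfl
  have hC : ∑ e ∈ (gr M).erase p,
      (((avoidSets M p).filter (fun X => e ∈ X ∧ e ∈ clF M (gr M \ X))).card : ℤ) = crossIn M p := by
    exact_mod_cast sum_card_avoid_crossIn (M := M) p
  have hD : ∑ e ∈ (gr M).erase p,
      (((avoidSets M p).filter (fun X => e ∉ X ∧ e ∈ clF M X)).card : ℤ) =
      (crossOut M p : ℤ) - (capSets M p).card := by
    have h0 := sum_card_avoid_crossOut (M := M) hp
    have h1 : ((∑ e ∈ (gr M).erase p, ((avoidSets M p).filter (fun X => e ∉ X ∧ e ∈ clF M X)).card +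
        (capSets M p).card : ℕ) : ℤ) = (crossOut M p : ℤ) := by exact_mod_cast h0
    push_cast at h1
    linarith
  rw [hA, hB, hC, hD] at hsum
  rw [← sum_sub_distrib] at hsum
  have h2 : ∑ X ∈ avoidSets M p, (2 * (X.card : ℤ) - (gr M).card + 1) =
      ∑ X ∈ avoidSets M p, ((X.card : ℤ) - (((gr M).card : ℤ) - 1 - X.card)) := by
    apply sum_congr rfl
    intro X _
    ring
  rw [h2]
  linarith

/-- **IDENTITY II**: the complement `X ↦ (E∖p) ∖ X` is an involution of `CC` reversing the sign of `2 #X − N + 1`, so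
`Σ_{X ∈ CC} (2 #X − N + 1) = 0`. -/
theorem sum_extSets_signed {p : α} (hp : p ∈ gr M) :
    ∑ X ∈ extSets M p, (2 * (X.card : ℤ) - (gr M).card + 1) = 0 := by
  have hsub : ∀ X ∈ extSets M p, X ⊆ (gr M).erase p := fun X hX =>
    subset_erase_of_mem_avoidSets (mem_filter.1 hX).1
  have hmem : ∀ X ∈ extSets M p, (gr M).erase p \ X ∈ extSets M p := by
    intro X hX
    have hX' := hX
    unfold extSets at hX'
    rw [mem_filter, mem_avoidSets] at hX'
    obtain ⟨⟨hXb, hpX⟩, hcl⟩ := hX'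
    have hXg : X ⊆ gr M := (mem_biIndepAll.1 hXb).1
    have hcomp : gr M \ ((gr M).erase p \ X) = insert p X := by
      ext x
      constructor
      · intro hx
        rw [mem_sdiff, mem_sdiff, mem_erase] at hx
        rw [mem_insert]
        by_cases hxp : x = p
        · exact Or.inl hxp
        · right
          by_contra hxX
          exact hx.2 ⟨⟨hxp, hx.1⟩, hxX⟩
      · intro hx
        rw [mem_insert] at hx
        rw [mem_sdiff, mem_sdiff, mem_erase]
        rcases hx with rfl | hx
        · exact ⟨hp, fun h => h.1.1 rfl⟩
        · exact ⟨hXg hx, fun h => h.2 hx⟩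
    have hins : insert p X ∈ biIndepAll M := (insert_mem_biIndepAll_iff hXb hp hpX).2 hcl
    have hY : (gr M).erase p \ X ∈ biIndepAll M := by
      have h1 := sdiff_mem_biIndepAll hins
      have h2 : gr M \ insert p X = (gr M).erase p \ X := by
        ext x
        simp only [mem_sdiff, mem_insert, mem_erase, not_or]
        tauto
      rwa [h2] at h1
    have hpY : p ∉ (gr M).erase p \ X := fun h => (mem_erase.1 (mem_sdiff.1 h).1).1 rfl
    unfold extSets
    rw [mem_filter, mem_avoidSets]
    refine ⟨⟨hY, hpY⟩, ?_⟩
    rw [← insert_mem_biIndepAll_iff hY hp hpY]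
    have h3 : insert p ((gr M).erase p \ X) = gr M \ X := by
      ext x
      simp only [mem_insert, mem_sdiff, mem_erase]
      constructor
      · rintro (rfl | ⟨⟨_, hxg⟩, hx⟩)
        · exact ⟨hp, hpX⟩
        · exact ⟨hxg, hx⟩
      · rintro ⟨hxg, hx⟩
        by_cases hxp : x = p
        · exact Or.inl hxp
        · exact Or.inr ⟨⟨hxp, hxg⟩, hx⟩
    rw [h3]
    exact sdiff_mem_biIndepAll hXb
  have hN : 1 ≤ (gr M).card := card_pos.2 ⟨p, hp⟩
  apply sum_involution (fun X _ => (gr M).erase p \ X)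
  · intro X hX
    rw [card_sdiff_of_subset (hsub X hX), card_erase_of_mem hp]
    have h1 : X.card + 1 ≤ (gr M).card := by
      have := card_le_card (hsub X hX)
      rw [card_erase_of_mem hp] at this
      omega
    rw [Nat.cast_sub (by omega : X.card ≤ (gr M).card - 1), Nat.cast_sub hN]
    push_cast
    ring
  · intro X hX hne heq
    apply hne
    have h1 : X.card = ((gr M).erase p \ X).card := by rw [heq]
    rw [card_sdiff_of_subset (hsub X hX), card_erase_of_mem hp] at h1
    have h2 : X.card + 1 ≤ (gr M).card := by
      have := card_le_card (hsub X hX)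
      rw [card_erase_of_mem hp] at this
      omega
    have h3 : 2 * X.card + 1 = (gr M).card := by omega
    have h4 : (2 * X.card + 1 : ℤ) = (gr M).card := by exact_mod_cast h3
    linarith
  · intro X hX
    exact hmem X hX
  · intro X hX
    exact Finset.sdiff_sdiff_eq_self (hsub X hX)

/-- **THE IDENTITY**: `Σ_{X ∈ 𝒦} (2 #X − N) = S1 − S2`. -/
theorem sum_capSets_eq_cross {p : α} (hp : p ∈ gr M) :
    ∑ X ∈ capSets M p, (2 * (X.card : ℤ) - (gr M).card) = (crossIn M p : ℤ) - crossOut M p := by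
  have h1 := sum_avoid_signed (M := M) hp
  have h2 := sum_extSets_signed (M := M) hp
  have hsplit := sum_filter_add_sum_filter_not (avoidSets M p) (fun X => p ∈ clF M X)
    (fun X => 2 * (X.card : ℤ) - (gr M).card + 1)
  have hcap : (avoidSets M p).filter (fun X => p ∈ clF M X) = capSets M p := rfl
  have hext : (avoidSets M p).filter (fun X => ¬ p ∈ clF M X) = extSets M p := rfl
  rw [hcap, hext, h2, add_zero] at hsplit
  have h3 : ∑ X ∈ capSets M p, (2 * (X.card : ℤ) - (gr M).card + 1) =
      ∑ X ∈ capSets M p, (2 * (X.card : ℤ) - (gr M).card) + (capSets M p).card := by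
    rw [sum_add_distrib, sum_const, nsmul_eq_mul, mul_one]
  linarith

/-- The captured first moment by levels: `Σ_{X ∈ 𝒦} (2 #X − N) = Σ_k (2k − N) κ_k`. -/
theorem sum_capSets_eq_levels (p : α) :
    ∑ X ∈ capSets M p, (2 * (X.card : ℤ) - (gr M).card) =
      ∑ k ∈ range ((gr M).card + 1), ((2 * (k : ℤ) - (gr M).card) * (capCount M k p : ℤ)) := by
  rw [← sum_fiberwise_of_maps_to (s := capSets M p) (t := range ((gr M).card + 1)) (g := fun X => X.card)
    (fun X hX => by
      rw [mem_range]
      have := card_le_card (mem_biIndepAll.1 (mem_avoidSets.1 (mem_filter.1 hX).1).1).1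
      omega)]
  apply sum_congr rfl
  intro k _
  rw [← card_capSets_filter p k]
  rw [sum_congr rfl (fun X hX => by rw [(mem_filter.1 hX).2]), sum_const, nsmul_eq_mul]
  ring

/-- **(C1′) ⟺ (★)**: the captured first moment is non-negative iff `p` prefers the spanning side. -/
theorem capLimit_iff_pointedSpanning : CapLimit α ↔ PointedSpanning α := by
  have key : ∀ (M : Matroid α) [M.Finite] (p : α), p ∈ gr M →
      (((gr M).card * ∑ k ∈ range ((gr M).card + 1), capCount M k p ≤
        2 * ∑ k ∈ range ((gr M).card + 1), k * capCount M k p) ↔ crossOut M p ≤ crossIn M p) := by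
    intro M _ p hp
    have h1 := sum_capSets_eq_cross (M := M) hp
    have h2 := sum_capSets_eq_levels (M := M) p
    have h3 : ∑ k ∈ range ((gr M).card + 1), ((2 * (k : ℤ) - (gr M).card) * (capCount M k p : ℤ)) =
        2 * ((∑ k ∈ range ((gr M).card + 1), k * capCount M k p : ℕ) : ℤ) -
          ((gr M).card : ℤ) * ((∑ k ∈ range ((gr M).card + 1), capCount M k p : ℕ) : ℤ) := by
      push_cast
      rw [mul_sum, mul_sum, ← sum_sub_distrib]
      apply sum_congr rfl
      intro k _
      ring
    rw [h2, h3] at h1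
    constructor
    · intro h
      have h4 : ((gr M).card : ℤ) * ((∑ k ∈ range ((gr M).card + 1), capCount M k p : ℕ) : ℤ) ≤
          2 * ((∑ k ∈ range ((gr M).card + 1), k * capCount M k p : ℕ) : ℤ) := by exact_mod_cast h
      have h5 : (crossOut M p : ℤ) ≤ crossIn M p := by linarith
      exact_mod_cast h5
    · intro h
      have h4 : (crossOut M p : ℤ) ≤ crossIn M p := by exact_mod_cast h
      have h5 : ((gr M).card : ℤ) * ((∑ k ∈ range ((gr M).card + 1), capCount M k p : ℕ) : ℤ) ≤
          2 * ((∑ k ∈ range ((gr M).card + 1), k * capCount M k p : ℕ) : ℤ) := by linarith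
      exact_mod_cast h5
  constructor
  · intro h M _ p hp
    exact (key M p hp).1 (h M p hp)
  · intro h M _ p hp
    exact (key M p hp).2 (h M p hp)

end PercRepro.Cogirth
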